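import Mathlib.CategoryTheory.CofilteredSystem
import Mathlib.CategoryTheory.Functor.OfSequence
import Mathlib.GroupTheory.Index
import Mathlib.LinearAlgebra.Charpoly.BaseChange
import Literature.NumberTheory.EllipticCurves.TateModuleRank
import Literature.LinearAlgebra.FreeModule.DetQuotientPadicCard
import HarnessLib

/-!
# `#ker(u)(p) = #Coker(T_p u) = |det T_p(u)|_p⁻¹` (Milne, *Abelian Varieties*, proof of Prop. 12.9)

Sibling proof file (theorems only, no named facts, no definitions) of `TateModule` /
`TateModuleRank`, in the generic setting of those files: an abelian group `A`, a prime `p` with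
`#A[p^n] = p^{dn}` for all `n` (so that `T_p A ≅ ℤ_p^d`, `TateModuleRank`), and an endomorphism
`u : A →+ A` whose kernel has FINITE `p`-power torsion `K = ker(u) ∩ A[p^∞]`.

This is the step
*"`|deg(β)|_l = |#(ker(β))|_l = #(ker(β)(l))⁻¹ = #(Coker(T_l β))⁻¹ = |det(T_l β)|_l`"*
of the printed proof of Milne's Prop. 12.9 (the characteristic polynomial of an endomorphism of an
abelian variety is the characteristic polynomial of `T_l`; Cornell–Silverman p. 125, PDF p. 193;
the same computation is Mumford, *Abelian Varieties*, §19, proof of Thm. 4), isolated as pure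
Tate-module algebra — the two outer equalities (`deg = #ker` for separable isogenies, the `l`-part
of a finite group) are where the geometry enters and are not part of this file:

* `TateModule.map_injective_of_finite_torsion_ker` — `T_p(u)` is injective as soon as `K` is
  finite (no counting hypothesis needed);
* `TateModule.exists_mem_torsionBy_apply_eq` — `u` maps `A[p^{n + #K}]` onto a set containing
  `A[p^n]` (`u` is surjective on `A[p^∞]`: the image of `u | A[p^N]` has index `#ker ≤ #K`);
* `TateModule.exists_connectingHom` — the connecting homomorphism `Δ : T_p A ↠ K`,
  `Δ(y) = p^n x` for any `p`-power-torsion `x` with `u x = y_n` (`n ≫ 0`), is onto with kernel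
  `T_p(u)(T_p A)` (snake lemma on the tower `A[p^n]`; exactness in the middle is Kőnig's lemma on
  the finite non-empty sets of level-`n` lifts);
* `TateModule.natCard_quotient_range_map` — **`#Coker(T_p u) = #K`**;
* `TateModule.natCard_torsion_ker_eq_pow_valuation_det`,
  `TateModule.norm_det_map_eq_inv_natCard` — **`#K = p^{v_p(det T_p u)} = |det T_p(u)|_p⁻¹`**
  (through the tree's `ℤ_p`-Smith-normal-form count
  `Literature.LinearAlgebra.FreeModule.natCard_quotient_range_eq_pow_valuation_det`);
* `TateModule.norm_det_one_sub_tateRepresentation`,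
  `RationalTateModule.norm_det_one_sub_rationalTateRepresentation` — the case `u = 1 - g` for a
  monoid `G` acting on `A`: **`|det(1 - g | V_p A)|_p = (#(A^g ∩ A[p^∞]))⁻¹`**, the form in which
  fixed points of a Frobenius are counted `p`-adically (Mumford §19 Thm. 4, Milne 12.9 applied to
  `F(φ)`).

## References

* [Milne1986AbelianVarieties] J. S. Milne, *Abelian varieties*, in: G. Cornell, J. H. Silverman
  (eds.), *Arithmetic Geometry*, Springer 1986, §12, proof of Prop. 12.9, p. 125 (PDF p. 193 of
  the held copy `book:cornellnd-arithmetic-geometry`).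
* [MumfordAV1970] D. Mumford, *Abelian Varieties*, Oxford Univ. Press 1970, §19, Thm. 4 and its
  proof (`#ker = |det T_l|_l⁻¹`).
* [SilvermanAEC2009] J. H. Silverman, *The Arithmetic of Elliptic Curves*, 2nd ed., III.§7
  (Tate module conventions of the parent files).

## Design

Pure theorems in `namespace Literature.NumberTheory.EllipticCurves.TateModule` (generic `A`, as
`TateModuleRank`); the `p`-power-torsion kernel is the SET
`{a : A | (∃ n : ℕ, p ^ n • a = 0) ∧ u a = 0}` (no new definition), its finiteness a `Set.Finite`
hypothesis.  Kőnig's lemma is Mathlib's `nonempty_sections_of_finite_inverse_system` through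
`Functor.ofOpSequence` (a private sequential copy, as in
`Literature.NumberTheory.GaloisRepresentations.Deformation.exists_seq_compat_of_finite`, to keep
the import cone of the Tate-module files free of deformation theory).
-/

noncomputable section

open scoped Classical AddSubgroup TensorProduct

universe u

namespace Literature.NumberTheory.EllipticCurves

namespace TateModule

variable {A : Type u} [AddCommGroup A] {p : ℕ}

/-! ### Kőnig's lemma, sequential form -/

section Konig

open CategoryTheory

/-- Kőnig's lemma for a tower `S₀ ← S₁ ← ⋯` of finite non-empty types (Mathlib's
`nonempty_sections_of_finite_inverse_system` through `Functor.ofOpSequence`; private copy of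
`Literature.NumberTheory.GaloisRepresentations.Deformation.exists_seq_compat_of_finite`). [folklore] -/
private theorem exists_seq_compat {S : ℕ → Type u} [∀ n, Finite (S n)] [∀ n, Nonempty (S n)]
    (f : ∀ n, S (n + 1) → S n) : ∃ x : ∀ n, S n, ∀ n, f n (x (n + 1)) = x n := by
  let F : ℕᵒᵖ ⥤ Type u := Functor.ofOpSequence (X := S) fun n => TypeCat.ofHom (f n)
  haveI : ∀ j : ℕᵒᵖ, Finite (F.obj j) := fun j => inferInstanceAs (Finite (S j.unop))
  haveI : ∀ j : ℕᵒᵖ, Nonempty (F.obj j) := fun j => inferInstanceAs (Nonempty (S j.unop))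
  obtain ⟨s, hs⟩ := nonempty_sections_of_finite_inverse_system F
  refine ⟨fun n => s (Opposite.op n), fun n => ?_⟩
  have h := hs ((homOfLE (Nat.le_add_right n 1)).op)
  have hmap := Functor.ofOpSequence_map_homOfLE_succ (X := S) (fun n => TypeCat.ofHom (f n)) n
  rw [show F.map (homOfLE (Nat.le_add_right n 1)).op = TypeCat.ofHom (f n) from hmap] at h
  exact h

end Konig

/-! ### `p`-power torsion bookkeeping -/

/-- A finite set of `p`-power-torsion elements is killed by one power `p ^ m`. [folklore] -/
private theorem exists_pow_smul_eq_zero_of_finite {S : Set A} (hS : S.Finite)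
    (hT : ∀ a ∈ S, ∃ n : ℕ, p ^ n • a = 0) : ∃ m : ℕ, ∀ a ∈ S, p ^ m • a = 0 := by
  have key : ∀ a ∈ hS.toFinset, ∃ n : ℕ, p ^ n • a = 0 := fun a ha =>
    hT a (hS.mem_toFinset.mp ha)
  choose! f hf using key
  refine ⟨hS.toFinset.sup f, fun a ha => ?_⟩
  have ha' : a ∈ hS.toFinset := hS.mem_toFinset.mpr ha
  obtain ⟨k, hk⟩ := Nat.exists_eq_add_of_le' (Finset.le_sup (f := f) ha')
  rw [hk, pow_add, mul_smul, hf a ha', smul_zero]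

/-- Sums of `p`-power-torsion elements are `p`-power torsion. [folklore] -/
private theorem exists_pow_smul_add_eq_zero {a b : A} (ha : ∃ n : ℕ, p ^ n • a = 0)
    (hb : ∃ n : ℕ, p ^ n • b = 0) : ∃ n : ℕ, p ^ n • (a + b) = 0 := by
  obtain ⟨i, hi⟩ := ha
  obtain ⟨j, hj⟩ := hb
  refine ⟨i + j, ?_⟩
  rw [smul_add, pow_add, mul_smul, mul_smul, hj, smul_zero, add_zero, smul_comm, hi, smul_zero]

/-- Differences of `p`-power-torsion elements are `p`-power torsion. [folklore] -/
private theorem exists_pow_smul_sub_eq_zero {a b : A} (ha : ∃ n : ℕ, p ^ n • a = 0)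
    (hb : ∃ n : ℕ, p ^ n • b = 0) : ∃ n : ℕ, p ^ n • (a - b) = 0 := by
  obtain ⟨j, hj⟩ := hb
  rw [sub_eq_add_neg]
  exact exists_pow_smul_add_eq_zero ha ⟨j, by rw [smul_neg, hj, neg_zero]⟩

/-- Multiples of a `p`-power-torsion element are `p`-power torsion. [folklore] -/
private theorem exists_pow_smul_nsmul_eq_zero {a : A} (ha : ∃ n : ℕ, p ^ n • a = 0) (k : ℕ) :
    ∃ n : ℕ, p ^ n • (k • a) = 0 := by
  obtain ⟨i, hi⟩ := ha
  exact ⟨i, by rw [smul_comm, hi, smul_zero]⟩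

/-- An additive endomorphism preserves `A[p^N]`. [folklore] -/
private theorem apply_mem_torsionBy (u : A →+ A) {N : ℕ} {a : A} (ha : a ∈ A[(p ^ N : ℕ)]) :
    u a ∈ A[(p ^ N : ℕ)] := by
  rw [AddSubgroup.torsionBy.nsmul_iff] at ha ⊢
  rw [← map_nsmul, ha, map_zero]

/-- Two `p`-power-torsion elements with the same image under `u` differ by an element of
`K = ker(u) ∩ A[p^∞]`; if `p ^ m` kills `K` they agree after multiplication by `p ^ n`, `n ≥ m`.
[folklore] -/
private theorem pow_smul_eq_of_apply_eq {u : A →+ A} {m : ℕ}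
    (hm : ∀ a : A, (∃ n : ℕ, p ^ n • a = 0) → u a = 0 → p ^ m • a = 0) {n : ℕ} (hn : m ≤ n)
    {x x' : A} (hx : ∃ k : ℕ, p ^ k • x = 0) (hx' : ∃ k : ℕ, p ^ k • x' = 0) (he : u x = u x') :
    p ^ n • x = p ^ n • x' := by
  obtain ⟨e, rfl⟩ := Nat.exists_eq_add_of_le hn
  rw [← sub_eq_zero, ← smul_sub, pow_add, mul_comm, mul_smul,
    hm (x - x') (exists_pow_smul_sub_eq_zero hx hx') (by rw [map_sub, he, sub_self]), smul_zero]

section Prime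

variable [Fact p.Prime]

/-! ### `T_p(u)` is injective -/

/-- **`T_p(u)` is injective when `ker(u) ∩ A[p^∞]` is finite**: if `p ^ m` kills that finite
group and `T_p(u)(x) = 0`, every component `x_{n+m}` lies in it, so `x_n = p^m x_{n+m} = 0`.
[cite: Milne1986AbelianVarieties, §12, proof of Prop. 12.9, p. 125] -/
theorem map_injective_of_finite_torsion_ker (u : A →+ A)
    (hfin : {a : A | (∃ n : ℕ, p ^ n • a = 0) ∧ u a = 0}.Finite) :
    Function.Injective (map p u) := by
  obtain ⟨m, hm⟩ := exists_pow_smul_eq_zero_of_finite hfin fun a ha => ha.1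
  refine (injective_iff_map_eq_zero _).mpr fun x hx => TateModule.ext fun n => ?_
  rw [map_zero, ← pow_smul_proj_add x n m]
  exact hm _ ⟨⟨n + m, pow_smul_proj (n + m) x⟩, by rw [← proj_map, hx, map_zero]⟩

variable {d : ℕ}

/-! ### `u` is surjective on `A[p^∞]` -/

/-- **`u` maps `A[p^{n+c}]` onto a subgroup containing `A[p^n]`, `c = #(ker(u) ∩ A[p^∞])`**, under
the counting hypothesis `#A[p^N] = p^{dN}`: for `y ∈ A[p^n]` pick `y' ∈ A[p^{n+c}]` with
`p^c y' = y` (the projections `T_p A → A[p^N]` are onto); the image of `u | A[p^{n+c}]` has index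
`#ker(u | A[p^{n+c}]) = p^j ≤ c` in `A[p^{n+c}]`, so contains `p^j y'` and a fortiori `p^c y' = y`.
[cite: Milne1986AbelianVarieties, §12, proof of Prop. 12.9, p. 125] -/
theorem exists_mem_torsionBy_apply_eq (hcard : ∀ n, Nat.card (A[(p ^ n : ℕ)]) = p ^ (d * n))
    (u : A →+ A) (hfin : {a : A | (∃ n : ℕ, p ^ n • a = 0) ∧ u a = 0}.Finite) (n : ℕ) {y : A}
    (hy : y ∈ A[(p ^ n : ℕ)]) :
    ∃ x ∈ A[(p ^ (n + Nat.card {a : A | (∃ n : ℕ, p ^ n • a = 0) ∧ u a = 0}) : ℕ)], u x = y := by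
  have hp : p.Prime := Fact.out
  haveI : Finite {a : A | (∃ n : ℕ, p ^ n • a = 0) ∧ u a = 0} := hfin.to_subtype
  set c := Nat.card {a : A | (∃ n : ℕ, p ^ n • a = 0) ∧ u a = 0}
  haveI := finite_torsionBy_of_card hcard (n + c)
  -- a `p ^ c`-th root `y'` of `y` in `A[p^(n+c)]`
  obtain ⟨a, ha⟩ := proj_surjective_of_card hcard n hy
  let y' : A[(p ^ (n + c) : ℕ)] := ⟨proj p (n + c) a, proj_mem_torsionBy (n + c) a⟩
  have hy' : p ^ c • (y' : A) = y := by rw [← ha]; exact pow_smul_proj_add a n c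
  -- the restriction of `u` to `A[p^(n+c)]`
  let uN : A[(p ^ (n + c) : ℕ)] →+ A[(p ^ (n + c) : ℕ)] :=
    (u.comp (A[(p ^ (n + c) : ℕ)]).subtype).codRestrict (A[(p ^ (n + c) : ℕ)])
      fun x => apply_mem_torsionBy u x.2
  have huN : ∀ x, ((uN x : A[(p ^ (n + c) : ℕ)]) : A) = u x := fun x => rfl
  -- its kernel embeds in `ker(u) ∩ A[p^∞]`
  have hker : Nat.card uN.ker ≤ c := by
    refine Nat.card_le_card_of_injective
      (fun x => (⟨((x : A[(p ^ (n + c) : ℕ)]) : A),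
        ⟨n + c, AddSubgroup.torsionBy.nsmul_iff.mp x.1.2⟩, ?_⟩ :
          {a : A | (∃ n : ℕ, p ^ n • a = 0) ∧ u a = 0})) ?_
    · rw [← huN]
      exact congrArg Subtype.val ((AddMonoidHom.mem_ker).mp x.2)
    · intro x₁ x₂ h
      exact Subtype.ext (Subtype.ext (by simpa using congrArg Subtype.val h))
  -- so its image has index `p ^ j ≤ c`
  have hidx : uN.range.index = Nat.card uN.ker := AddSubgroup.index_range
  have hdvd : uN.range.index ∣ p ^ (d * (n + c)) := by
    rw [← hcard (n + c)]
    exact uN.range.index_dvd_card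
  obtain ⟨j, -, hj⟩ := (Nat.dvd_prime_pow hp).mp hdvd
  have hjc : j ≤ c := by
    have h : p ^ j ≤ c := by rw [← hj, hidx]; exact hker
    exact ((Nat.lt_pow_self hp.one_lt).trans_le h).le
  -- hence `p ^ c • y'` lies in the image
  have hmem : p ^ c • y' ∈ uN.range := by
    rw [show p ^ c = p ^ (c - j) * p ^ j by rw [← pow_add, Nat.sub_add_cancel hjc], mul_smul]
    exact uN.range.nsmul_mem (hj ▸ uN.range.nsmul_index_mem y') _
  obtain ⟨x, hx⟩ := hmem
  refine ⟨x, x.2, ?_⟩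
  rw [← huN, hx, AddSubgroup.coe_nsmul]
  exact hy'

/-! ### The connecting homomorphism `T_p A ↠ ker(u) ∩ A[p^∞]` -/

omit [Fact p.Prime] in
/-- `p^n x ∈ ker(u) ∩ A[p^∞]` for a `p`-power-torsion `x` with `u x = y_n`. [folklore] -/
private theorem pow_smul_mem_of_apply_eq_proj {u : A →+ A} {n : ℕ} {y : TateModule A p} {x : A}
    (hx : ∃ k : ℕ, p ^ k • x = 0) (hux : u x = proj p n y) :
    p ^ n • x ∈ {a : A | (∃ k : ℕ, p ^ k • a = 0) ∧ u a = 0} :=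
  ⟨exists_pow_smul_nsmul_eq_zero hx _, by rw [map_nsmul, hux, pow_smul_proj]⟩

/-- **The connecting homomorphism** (snake lemma for `u` on the tower `A[p] ← A[p²] ← ⋯`): under
`#A[p^N] = p^{dN}` and finiteness of `K = ker(u) ∩ A[p^∞]` there is an additive map
`Δ : T_p A → A` with image exactly `K` and kernel exactly `T_p(u)(T_p A)`.  Construction:
`Δ(y) = p^n • x` for any `n ≥ m` (`p^m K = 0`) and any `p`-power-torsion `x` with `u x = y_n`
(lifts exist by `exists_mem_torsionBy_apply_eq`, the value does not depend on the choices by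
`pow_smul_eq_of_apply_eq`).  Image: `u(p^n x) = p^n y_n = 0`; conversely `κ ∈ K ⊆ A[p^m]` is
`Δ` of `(u(a_{m+n}))_n` for any `a ∈ T_p A` with `a_m = κ`.  Kernel: `Δ(T_p(u) b) = p^m b_m = 0`;
conversely if `Δ(y) = 0` the sets `{x ∈ A[p^n] : u x = y_n}` are finite and non-empty for all
`n`, so (Kőnig) contain a compatible sequence `b` with `T_p(u) b = y`.
[cite: Milne1986AbelianVarieties, §12, proof of Prop. 12.9, p. 125]
[cite: MumfordAV1970, §19, proof of Thm. 4] -/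
theorem exists_connectingHom (hcard : ∀ n, Nat.card (A[(p ^ n : ℕ)]) = p ^ (d * n)) (u : A →+ A)
    (hfin : {a : A | (∃ n : ℕ, p ^ n • a = 0) ∧ u a = 0}.Finite) :
    ∃ Δ : TateModule A p →+ A,
      Set.range Δ = {a : A | (∃ n : ℕ, p ^ n • a = 0) ∧ u a = 0} ∧
        Δ.ker = (LinearMap.range (map p u)).toAddSubgroup := by
  obtain ⟨m, hm⟩ := exists_pow_smul_eq_zero_of_finite hfin fun a ha => ha.1
  replace hm : ∀ a : A, (∃ n : ℕ, p ^ n • a = 0) → u a = 0 → p ^ m • a = 0 :=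
    fun a h1 h2 => hm a ⟨h1, h2⟩
  -- `p`-power-torsion lifts of `y_n` through `u` exist at every level `n`
  have hlift : ∀ (n : ℕ) (y : TateModule A p),
      ∃ x : A, (∃ k : ℕ, p ^ k • x = 0) ∧ u x = proj p n y := by
    intro n y
    obtain ⟨x, hx, hux⟩ := exists_mem_torsionBy_apply_eq hcard u hfin n (proj_mem_torsionBy n y)
    exact ⟨x, ⟨_, AddSubgroup.torsionBy.nsmul_iff.mp hx⟩, hux⟩
  choose L hL using hlift
  -- well-definedness: every lift at every level `n ≥ m` computes `p ^ m • L m y`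
  have hwd : ∀ (n : ℕ) (y : TateModule A p) (x : A), m ≤ n → (∃ k : ℕ, p ^ k • x = 0) →
      u x = proj p n y → p ^ n • x = p ^ m • L m y := by
    intro n y x hn hx hux
    obtain ⟨e, rfl⟩ := Nat.exists_eq_add_of_le hn
    rw [pow_add, mul_smul]
    refine pow_smul_eq_of_apply_eq hm le_rfl (exists_pow_smul_nsmul_eq_zero hx _) (hL m y).1 ?_
    rw [map_nsmul, hux, (hL m y).2]
    exact pow_smul_proj_add y m e
  -- the connecting map
  let Δ : TateModule A p →+ A :=
    { toFun := fun y => p ^ m • L m y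
      map_zero' := by
        have h := hwd m 0 0 le_rfl ⟨0, smul_zero _⟩ (by rw [map_zero, map_zero])
        rw [smul_zero] at h
        exact h.symm
      map_add' := fun y y' => by
        have h := hwd m (y + y') (L m y + L m y') le_rfl
          (exists_pow_smul_add_eq_zero (hL m y).1 (hL m y').1)
          (by rw [map_add, (hL m y).2, (hL m y').2, map_add])
        rw [← h, smul_add] }
  have hΔ : ∀ y, Δ y = p ^ m • L m y := fun y => rfl
  refine ⟨Δ, Set.Subset.antisymm ?_ ?_, AddSubgroup.ext fun y => ?_⟩
  · -- `Δ(T_p A) ⊆ K`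
    rintro _ ⟨y, rfl⟩
    exact pow_smul_mem_of_apply_eq_proj (hL m y).1 (hL m y).2
  · -- `K ⊆ Δ(T_p A)`
    rintro κ ⟨hκ, huκ⟩
    have hκm : κ ∈ A[(p ^ m : ℕ)] := AddSubgroup.torsionBy.nsmul_iff.mpr (hm κ hκ huκ)
    obtain ⟨a, ha⟩ := proj_surjective_of_card hcard m hκm
    let y : TateModule A p := mk (fun n => u (proj p (m + n) a))
      (fun n => by rw [← map_nsmul, pow_smul_proj_add a m n, ha, huκ])
      (fun n => by rw [← map_nsmul]; exact congrArg u (smul_proj_succ (m + n) a))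
    refine ⟨y, ?_⟩
    rw [hΔ, ← hwd m y (proj p (m + m) a) le_rfl ⟨m + m, pow_smul_proj _ a⟩ (by rw [proj_mk]),
      pow_smul_proj_add a m m, ha]
  · -- `ker Δ = T_p(u)(T_p A)`
    rw [AddMonoidHom.mem_ker, Submodule.mem_toAddSubgroup, LinearMap.mem_range]
    constructor
    · intro hy
      -- the level-`k` lifts inside `A[p^k]` form a tower of finite non-empty sets
      have hS : ∀ k, ∃ x : A, p ^ k • x = 0 ∧ u x = proj p k y := by
        intro k
        refine ⟨p ^ m • L (k + m) y, ?_, ?_⟩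
        · rw [← mul_smul, ← pow_add, hwd (k + m) y (L (k + m) y) (Nat.le_add_left m k)
            (hL _ y).1 (hL _ y).2, ← hΔ, hy]
        · rw [map_nsmul, (hL _ y).2, pow_smul_proj_add y k m]
      haveI : ∀ k, Nonempty {x : A // p ^ k • x = 0 ∧ u x = proj p k y} := fun k => by
        obtain ⟨x, hx⟩ := hS k
        exact ⟨⟨x, hx⟩⟩
      haveI : ∀ k, Finite {x : A // p ^ k • x = 0 ∧ u x = proj p k y} := fun k => by
        haveI := finite_torsionBy_of_card hcard k
        exact Finite.of_injective
          (fun x => (⟨x.1, AddSubgroup.torsionBy.nsmul_iff.mpr x.2.1⟩ : A[(p ^ k : ℕ)]))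
          fun x₁ x₂ h => Subtype.ext (by simpa using congrArg Subtype.val h)
      obtain ⟨x, hx⟩ := exists_seq_compat
        (S := fun k => {x : A // p ^ k • x = 0 ∧ u x = proj p k y}) fun k x =>
          ⟨p • x.1, by rw [smul_smul, ← pow_succ, x.2.1], by rw [map_nsmul, x.2.2, smul_proj_succ]⟩
      refine ⟨mk (fun k => (x k).1) (fun k => (x k).2.1) (fun k => congrArg Subtype.val (hx k)),
        TateModule.ext fun k => ?_⟩
      rw [proj_map, proj_mk]
      exact (x k).2.2
    · rintro ⟨b, rfl⟩
      rw [hΔ, ← hwd m (map p u b) (proj p m b) le_rfl ⟨m, pow_smul_proj m b⟩ (proj_map u b m).symm,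
        pow_smul_proj]

/-! ### `#Coker(T_p u) = #(ker(u) ∩ A[p^∞]) = |det T_p(u)|_p⁻¹` -/

/-- **`#Coker(T_p u) = #(ker(u) ∩ A[p^∞])`** (first isomorphism theorem for the connecting
homomorphism). [cite: Milne1986AbelianVarieties, §12, proof of Prop. 12.9, p. 125]
[cite: MumfordAV1970, §19, proof of Thm. 4] -/
theorem natCard_quotient_range_map (hcard : ∀ n, Nat.card (A[(p ^ n : ℕ)]) = p ^ (d * n))
    (u : A →+ A) (hfin : {a : A | (∃ n : ℕ, p ^ n • a = 0) ∧ u a = 0}.Finite) :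
    Nat.card (TateModule A p ⧸ LinearMap.range (map p u)) =
      Nat.card {a : A | (∃ n : ℕ, p ^ n • a = 0) ∧ u a = 0} := by
  obtain ⟨Δ, hrange, hker⟩ := exists_connectingHom hcard u hfin
  calc Nat.card (TateModule A p ⧸ LinearMap.range (map p u))
      = Nat.card (TateModule A p ⧸ Δ.ker) := by rw [hker]; rfl
    _ = Nat.card Δ.range := Nat.card_congr (QuotientAddGroup.quotientKerEquivRange Δ).toEquiv
    _ = Nat.card {a : A | (∃ n : ℕ, p ^ n • a = 0) ∧ u a = 0} :=
        Nat.card_congr (Equiv.subtypeEquivRight fun a => by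
          rw [← hrange, AddMonoidHom.mem_range, Set.mem_range])

/-- `det T_p(u) ≠ 0` when `ker(u) ∩ A[p^∞]` is finite (`T_p(u)` is injective on the finite free
`ℤ_p`-module `T_p A`). [folklore] -/
theorem det_map_ne_zero (hcard : ∀ n, Nat.card (A[(p ^ n : ℕ)]) = p ^ (d * n)) (u : A →+ A)
    (hfin : {a : A | (∃ n : ℕ, p ^ n • a = 0) ∧ u a = 0}.Finite) :
    LinearMap.det (map p u) ≠ 0 := by
  haveI := free_of_card_torsionBy_rank hcard
  haveI := finite_of_card_torsionBy_rank hcard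
  exact fun h => LinearMap.det_eq_zero_iff_ker_ne_bot.mp h
    (LinearMap.ker_eq_bot.mpr (map_injective_of_finite_torsion_ker u hfin))

/-- **`#(ker(u) ∩ A[p^∞]) = p ^ v_p(det T_p(u))`**.
[cite: Milne1986AbelianVarieties, §12, proof of Prop. 12.9, p. 125]
[cite: MumfordAV1970, §19, proof of Thm. 4] -/
theorem natCard_torsion_ker_eq_pow_valuation_det
    (hcard : ∀ n, Nat.card (A[(p ^ n : ℕ)]) = p ^ (d * n)) (u : A →+ A)
    (hfin : {a : A | (∃ n : ℕ, p ^ n • a = 0) ∧ u a = 0}.Finite) :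
    Nat.card {a : A | (∃ n : ℕ, p ^ n • a = 0) ∧ u a = 0} =
      p ^ (LinearMap.det (map p u)).valuation := by
  haveI := free_of_card_torsionBy_rank hcard
  haveI := finite_of_card_torsionBy_rank hcard
  rw [← natCard_quotient_range_map hcard u hfin]
  exact Literature.LinearAlgebra.FreeModule.natCard_quotient_range_eq_pow_valuation_det
    (Module.Free.chooseBasis ℤ_[p] (TateModule A p)) (map p u)
    (map_injective_of_finite_torsion_ker u hfin)

/-- **`|det T_p(u)|_p = (#(ker(u) ∩ A[p^∞]))⁻¹`**.
[cite: Milne1986AbelianVarieties, §12, proof of Prop. 12.9, p. 125]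
[cite: MumfordAV1970, §19, proof of Thm. 4] -/
theorem norm_det_map_eq_inv_natCard (hcard : ∀ n, Nat.card (A[(p ^ n : ℕ)]) = p ^ (d * n))
    (u : A →+ A) (hfin : {a : A | (∃ n : ℕ, p ^ n • a = 0) ∧ u a = 0}.Finite) :
    ‖LinearMap.det (map p u)‖ =
      ((Nat.card {a : A | (∃ n : ℕ, p ^ n • a = 0) ∧ u a = 0} : ℕ) : ℝ)⁻¹ := by
  rw [natCard_torsion_ker_eq_pow_valuation_det hcard u hfin,
    PadicInt.norm_eq_zpow_neg_valuation (det_map_ne_zero hcard u hfin), Nat.cast_pow,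
    ← zpow_natCast, ← zpow_neg]

/-! ### Fixed points: `u = 1 - g` for a monoid action -/

section Action

variable {G : Type*} [Monoid G] [DistribMulAction G A]

/-- `T_p(1 - g) = 1 - ρ_T(g)` on `T_p A`. [folklore] -/
theorem map_id_sub_toAddMonoidHom (g : G) :
    map p (AddMonoidHom.id A - DistribSMul.toAddMonoidHom A g) =
      1 - tateRepresentation G A p g := by
  refine LinearMap.ext fun x => TateModule.ext fun n => ?_
  rw [proj_map, LinearMap.sub_apply, map_sub, Module.End.one_apply, tateRepresentation_apply_apply,
    proj_smul_of_distribMulAction]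
  rfl

omit [Fact p.Prime] in
/-- The `p`-power-torsion kernel of `1 - g` is the `p`-power torsion of the fixed points `A^g`.
[folklore] -/
theorem setOf_torsion_ker_id_sub (g : G) :
    {a : A | (∃ n : ℕ, p ^ n • a = 0) ∧ (AddMonoidHom.id A - DistribSMul.toAddMonoidHom A g) a = 0} =
      {a : A | (∃ n : ℕ, p ^ n • a = 0) ∧ g • a = a} := by
  ext a
  simp only [Set.mem_setOf_eq, AddMonoidHom.sub_apply, AddMonoidHom.id_apply,
    DistribSMul.toAddMonoidHom_apply, sub_eq_zero]
  exact and_congr_right fun _ => eq_comm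

/-- **`|det(1 - g | T_p A)|_p = (#(A^g ∩ A[p^∞]))⁻¹`** for a monoid `G` acting on `A` with
`#A[p^N] = p^{dN}` and finitely many `p`-power-torsion fixed points of `g`.
[cite: Milne1986AbelianVarieties, §12, proof of Prop. 12.9, p. 125]
[cite: MumfordAV1970, §19, Thm. 4 (proof)] -/
theorem norm_det_one_sub_tateRepresentation
    (hcard : ∀ n, Nat.card (A[(p ^ n : ℕ)]) = p ^ (d * n)) (g : G)
    (hfin : {a : A | (∃ n : ℕ, p ^ n • a = 0) ∧ g • a = a}.Finite) :
    ‖LinearMap.det (1 - tateRepresentation G A p g)‖ =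
      ((Nat.card {a : A | (∃ n : ℕ, p ^ n • a = 0) ∧ g • a = a} : ℕ) : ℝ)⁻¹ := by
  rw [← map_id_sub_toAddMonoidHom, ← setOf_torsion_ker_id_sub (p := p) g]
  rw [← setOf_torsion_ker_id_sub (p := p) g] at hfin
  exact norm_det_map_eq_inv_natCard hcard _ hfin

end Action

end Prime

end TateModule

namespace RationalTateModule

variable {A : Type u} [AddCommGroup A] {p : ℕ} [Fact p.Prime] {d : ℕ}
variable {G : Type*} [Monoid G] [DistribMulAction G A]

/-- `ρ_V(g) = ℚ_p ⊗ ρ_T(g)` (unfolding `rationalTateRepresentation`). [folklore] -/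
theorem rationalTateRepresentation_eq_baseChange (g : G) :
    rationalTateRepresentation G A p g = (tateRepresentation G A p g).baseChange ℚ_[p] :=
  rfl

/-- `det(1 - g | V_p A) = det(1 - g | T_p A)` in `ℚ_p`, when `T_p A` is finite free (Mathlib
`LinearMap.det_baseChange`). [folklore] -/
theorem det_one_sub_rationalTateRepresentation [Module.Free ℤ_[p] (TateModule A p)]
    [Module.Finite ℤ_[p] (TateModule A p)] (g : G) :
    LinearMap.det (1 - rationalTateRepresentation G A p g) =
      ((LinearMap.det (1 - tateRepresentation G A p g) : ℤ_[p]) : ℚ_[p]) := by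
  have h : (1 - rationalTateRepresentation G A p g : Module.End ℚ_[p] (RationalTateModule A p)) =
      (1 - tateRepresentation G A p g).baseChange ℚ_[p] := by
    rw [LinearMap.baseChange_sub, LinearMap.baseChange_one]
    rfl
  calc LinearMap.det (1 - rationalTateRepresentation G A p g)
      = LinearMap.det ((1 - tateRepresentation G A p g).baseChange ℚ_[p]) := congrArg LinearMap.det h
    _ = ((LinearMap.det (1 - tateRepresentation G A p g) : ℤ_[p]) : ℚ_[p]) :=
        LinearMap.det_baseChange _

/-- **`|det(1 - g | V_p A)|_p = (#(A^g ∩ A[p^∞]))⁻¹`** for a monoid `G` acting on `A` with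
`#A[p^N] = p^{dN}` and finitely many `p`-power-torsion fixed points of `g` — the `p`-adic size of
`det(1 - g)` on `V_p A = ℚ_p ⊗ T_p A` counts the `p`-primary fixed points (Milne's
`#(ker(β)(l)) = #Coker(T_l β) = |det T_l β|_l⁻¹` for `β = 1 - g`).
[cite: Milne1986AbelianVarieties, §12, proof of Prop. 12.9, p. 125]
[cite: MumfordAV1970, §19, Thm. 4 (proof)] -/
theorem norm_det_one_sub_rationalTateRepresentation
    (hcard : ∀ n, Nat.card (A[(p ^ n : ℕ)]) = p ^ (d * n)) (g : G)
    (hfin : {a : A | (∃ n : ℕ, p ^ n • a = 0) ∧ g • a = a}.Finite) :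
    ‖LinearMap.det (1 - rationalTateRepresentation G A p g)‖ =
      ((Nat.card {a : A | (∃ n : ℕ, p ^ n • a = 0) ∧ g • a = a} : ℕ) : ℝ)⁻¹ := by
  haveI := TateModule.free_of_card_torsionBy_rank hcard
  haveI := TateModule.finite_of_card_torsionBy_rank hcard
  rw [det_one_sub_rationalTateRepresentation, PadicInt.padic_norm_e_of_padicInt]
  exact TateModule.norm_det_one_sub_tateRepresentation hcard g hfin

end RationalTateModule

end Literature.NumberTheory.EllipticCurves
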